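import Summits.Ventures.HSemireg.WedgeWeilRank

/-!
# Venture HSemireg — THEOREM R-B in the wedge model (6/9)

HONEST FRAMING. Part of the Lean index of the computation cell `pub-hsemireg` (seat p3; Sunday enclosure of the
FORMULA-N kernel assets of seats th-7 / th-6, ENCLOSURE-PLAN-p3.md).  Finite-dimensional exterior algebra over a field ONLY:
no variety, no cohomology theory, no semiregularity map is constructed here; nothing here says that HC / HC_CM / HC_AV holds;
no Literature fact is declared or used.  The geometric DICTIONARY (why these ranks are the `HT`-side box ranks of the cell's
STRUCTURE.md §1 / theory/FORMULA-N.md) lives in theory/FORMULA-N-th7.md PART B §A.3 / §N and is NOT asserted in Lean.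

THEOREM R-B (FORMULA-N PART B §L.3 / §L.8; STRUCTURE D9, (F1) Weil-frame clause, C16) in the SIGN-FREE transposed wedge model — theory/th7/WeilRank.lean v3 sha256/16 7e5d6bad1a94e25a (th-7 g4, 18:46Z; ×2 farm th-2 g20 18:48:20Z); PART R/R2/R3 = l.1506–3436 on top of HankelRank v1 (= the tree's Wedge/WedgeHankel* files), VERBATIM up
to namespaces (`HSemiregWeil` ↦ `Summit.Ventures.HSemireg.Wedge.Weil`, which sees the wedge-model infrastructure `….Wedge` and opens `….Wedge.Hankel`), file 6 of 9.
MODEL: `N` pairs of generators `x_c`, `y_c`; the h-part `f = w_N(q)` (HankelRank); the «Weil vectors» `w₊ = E_{G₋}`, `w₋ = E_{G₊}` = the full monomials on the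
generator blocks of the last `N − p` / first `p` pairs (signature `(p, N − p)`; THEOREM R is `N = 2n`, `p = n`).  HEADLINES (files 5, 8, 9): `weilRank` /
`weilRank_nn` («rank(⌟v ∣ HT²) = (4 + ρ)·n² − 2n», `v = f + a w₊ + b w₋`, `ab ≠ 0`, `n ≥ 3`, ρ = rank H₂(q)), `ker_eq` (kernel = mixed 2-forms killing `f`),
`weilRank_deg` / `weilRank_nn_deg` (every degree `m`, `m + 1 ≤ N − p`), `weilRank_one` / `weilRank_nn_one` (one-sided, ε = 1).  No permutation sign is evaluated
(the pair symmetries act through `AlternatingMap.map_perm`; `sgn κ` is a unit).  This file (PART R2, 1/3): degree-`m` mixed monomials `Mixm` / `Mm`, windows, separation in degree `m`, **`ker_eq_deg`**.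
-/

open Module Set Set.powersetCard Summit.Ventures.HSemireg.Wedge.Hankel

namespace Summit.Ventures.HSemireg.Wedge.Weil

variable (K : Type*) [Field K]

/-! ## PART R2 — THEOREM R IN EVERY DEGREE m < N − p (FORMULA-N PART B §L.8)
`rank(⌟v ∣ HT^m) = C(2p,m) + C(2(N−p),m) + (C(N,m) − C(p,m) − C(N−p,m))·rank H_m(q)`; for signature (n,n), m < n:
`C(2n,m)(2 + ρ_m) − 2ρ_m·C(n,m)` (gs-eng-1 WEIL-CONE-RANK §2″; STRUCTURE C16's HT¹ / HT³ entries 4n and 4C(2n,3) − 4C(n,3)). -/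

section AllDegrees

variable (N : ℕ)

/-- degree-`m` monomials; mixed degree-`m` monomials. -/
def Degm (m : ℕ) (s : Finset (In N)) : Prop := s ⊆ Finset.univ ∧ s.card = m
/-- mixed degree-`m` monomials: meeting both `G₊` and `G₋`. -/
def Mixm (m p : ℕ) (s : Finset (In N)) : Prop := s.card = m ∧ ¬ s ⊆ Dm N p ∧ ¬ s ⊆ Gm N p

/-- the mixed part of `Λ^m N` (monomials meeting both generator blocks). -/
noncomputable def Mm (m p : ℕ) : Submodule K (HT K (In N)) := Sp K (Mixm N m p)

/-- the windows of PART R, now of width `m`. -/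
def W0m (m p : ℕ) (r : Finset (In N)) : Prop := N - p ≤ μ p r ∧ μ p r ≤ N - p + m
/-- weight window of `θ ∧ w₋` in degree `m`: `μ ≤ m`. -/
def Wpm (m p : ℕ) (r : Finset (In N)) : Prop := μ p r ≤ m
/-- weight window of `θ ∧ w₊`: `μ ≥ 2N − 2p`. -/
def Wmm (p : ℕ) (r : Finset (In N)) : Prop := (N + N) - (p + p) ≤ μ p r

/-- selections: one generator from each pair of `S`, nothing else (`|t| = |S|`, `pr(t) = S`). -/
def Sel (S : Finset (Fin N)) (t : Finset (In N)) : Prop := t.card = S.card ∧ t.image pr = S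

variable {N}

/-- `Λ^m` as an `Sp`. -/
lemma Hom_univ_eq_Sp (m : ℕ) : Hom K (In N) Finset.univ m = Sp K (Degm N m) := rfl

/-- `Mm ≤ Λ^m`. -/
lemma Mm_le_Hom (m p : ℕ) : Mm K N m p ≤ Hom K (In N) Finset.univ m :=
  Sp_mono fun s hs => ⟨Finset.subset_univ s, hs.1⟩

/-- `θ ∧ f` lies in the window `W0m` for `θ ∈ Λ^m`. -/
lemma theta_mul_f_mem_deg {m p : ℕ} (q : ℕ → K) {θ : HT K (In N)} (hθ : θ ∈ Hom K (In N) Finset.univ m) :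
    θ * w K N N q ∈ Sp K (W0m N m p) := by
  refine mul_mem_Sp (P := Degm N m) (Q := Fsupp (N := N) p) (R := W0m N m p) ?_ hθ (f_mem_Sp K p q)
  intro s t hst hs ht
  have h1 : μ p (s ∪ t) = μ p s + μ p t := μ_union hst
  have h2 : μ p s ≤ m := (μ_le_card s).trans hs.2.le
  refine ⟨?_, ?_⟩ <;> rw [h1, ht.2] <;> omega

/-- `θ ∧ w₊` lies in the window `Wmm` for `θ ∈ Λ^m`. -/
lemma theta_mul_wplus_mem_deg {m p : ℕ} (hp : p ≤ N) {θ : HT K (In N)} (hθ : θ ∈ Hom K (In N) Finset.univ m) :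
    θ * B K (In N) (Gm N p) ∈ Sp K (Wmm N p) := by
  refine mul_mem_Sp (P := Degm N m) (Q := fun s => s = Gm N p) (R := Wmm N p) ?_ hθ (B_mem_Sp rfl)
  intro s t _ _ ht
  subst ht
  show (N + N) - (p + p) ≤ μ p (s ∪ Gm N p)
  rw [← card_Gm hp, ← μ_Gm]
  exact Finset.card_le_card (Finset.inter_subset_inter_right Finset.subset_union_right)

/-- `θ ∧ w₋` lies in the window `Wpm` for `θ ∈ Λ^m`. -/
lemma theta_mul_wminus_mem_deg {m p : ℕ} {θ : HT K (In N)} (hθ : θ ∈ Hom K (In N) Finset.univ m) :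
    θ * B K (In N) (Dm N p) ∈ Sp K (Wpm N m p) := by
  refine mul_mem_Sp (P := Degm N m) (Q := fun s => s = Dm N p) (R := Wpm N m p) ?_ hθ (B_mem_Sp rfl)
  intro s t hst hs ht
  subst ht
  show μ p (s ∪ Dm N p) ≤ m
  rw [μ_union hst, μ_Dm, add_zero]
  exact (μ_le_card s).trans hs.2.le

/-- K-weight separation in degree `m < N − p`. -/
lemma separation_deg {m p : ℕ} (hm : m + 1 ≤ N - p) (q : ℕ → K) {a b : K} {θ : HT K (In N)}
    (hθ : θ ∈ Hom K (In N) Finset.univ m) (h0 : θ * vW K N p q a b = 0) :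
    θ * w K N N q = 0 ∧ (a ≠ 0 → θ * B K (In N) (Gm N p) = 0) ∧ (b ≠ 0 → θ * B K (In N) (Dm N p) = 0) := by
  classical
  have hp : p ≤ N := by omega
  have e0 := theta_mul_f_mem_deg K (m := m) (p := p) q hθ
  have e1 := theta_mul_wplus_mem_deg K (m := m) hp hθ
  have e2 := theta_mul_wminus_mem_deg K (m := m) (p := p) hθ
  rw [vW_mul_expand] at h0
  have d01 : ∀ s, W0m N m p s → ¬ Wmm N p s := fun s h1 h2 => by unfold W0m at h1; unfold Wmm at h2; omega
  have d02 : ∀ s, W0m N m p s → ¬ Wpm N m p s := fun s h1 h2 => by unfold W0m at h1; unfold Wpm at h2; omega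
  have d12 : ∀ s, Wmm N p s → ¬ Wpm N m p s := fun s h1 h2 => by unfold Wmm at h1; unfold Wpm at h2; omega
  refine ⟨?_, ?_, ?_⟩
  · have := congrArg (proj (K := K) (W0m N m p)) h0
    rwa [map_add, map_add, map_smul, map_smul, map_zero, proj_eq_self (fun s h => h) e0,
      proj_eq_zero (fun s h => fun h' => d01 s h' h) e1, proj_eq_zero (fun s h => fun h' => d02 s h' h) e2,
      smul_zero, smul_zero, add_zero, add_zero] at this
  · intro ha
    have := congrArg (proj (K := K) (Wmm N p)) h0
    rwa [map_add, map_add, map_smul, map_smul, map_zero, proj_eq_zero d01 e0, proj_eq_self (fun s h => h) e1,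
      proj_eq_zero (fun s h => fun h' => d12 s h' h) e2, smul_zero, zero_add, add_zero, smul_eq_zero,
      or_iff_right ha] at this
  · intro hb
    have := congrArg (proj (K := K) (Wpm N m p)) h0
    rwa [map_add, map_add, map_smul, map_smul, map_zero, proj_eq_zero d02 e0,
      proj_eq_zero d12 e1, proj_eq_self (fun s h => h) e2, smul_zero, zero_add,
      zero_add, smul_eq_zero, or_iff_right hb] at this

/-- a degree-`m` form killing both Weil vectors is mixed. -/
lemma mem_Mm_of_mul_blocks_eq_zero {m p : ℕ} {θ : HT K (In N)} (hθ : θ ∈ Hom K (In N) Finset.univ m)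
    (h1 : θ * B K (In N) (Gm N p) = 0) (h2 : θ * B K (In N) (Dm N p) = 0) : θ ∈ Mm K N m p := by
  classical
  set P1 : Finset (In N) → Prop := fun s => s ⊆ Dm N p with hP1
  have hsplit1 := proj_add_proj_not (K := K) P1 θ
  have hθ1 : proj (K := K) P1 θ ∈ Alg K (In N) (Dm N p) :=
    Sp_mono (fun s hs => hs.2) (proj_mem_and (P := P1) hθ)
  have hθ1' : proj (K := K) (fun s => ¬ P1 s) θ ∈ Sp K (fun s => Degm N m s ∧ ¬ P1 s) := proj_mem_and hθ
  have hz1' : proj (K := K) (fun s => ¬ P1 s) θ * B K (In N) (Gm N p) = 0 := by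
    refine mul_B_eq_zero_of_mem_Sp (fun s hs hd => ?_) hθ1'
    obtain ⟨i, hi, hi'⟩ := Finset.not_subset.mp hs.2
    exact Finset.disjoint_left.mp hd hi (mem_Gm_of_not_mem_Dm hi')
  have hz1 : proj (K := K) P1 θ * B K (In N) (Gm N p) = 0 := by
    have := congrArg (· * B K (In N) (Gm N p)) hsplit1
    simp only [add_mul, hz1', add_zero, h1] at this
    exact this
  have hv1 : proj (K := K) P1 θ = 0 := eq_zero_of_mul_B_eq_zero K (disjoint_Dm_Gm p) hθ1 hz1
  rw [hv1, zero_add] at hsplit1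
  set θ' := proj (K := K) (fun s => ¬ P1 s) θ with hθ'
  set P2 : Finset (In N) → Prop := fun s => s ⊆ Gm N p with hP2
  have hsplit2 := proj_add_proj_not (K := K) P2 θ'
  have hθ2 : proj (K := K) P2 θ' ∈ Alg K (In N) (Gm N p) :=
    Sp_mono (fun s hs => hs.2) (proj_mem_and (P := P2) hθ1')
  have hθ2' : proj (K := K) (fun s => ¬ P2 s) θ' ∈ Sp K (fun s => (Degm N m s ∧ ¬ P1 s) ∧ ¬ P2 s) :=
    proj_mem_and hθ1'
  have hz2' : proj (K := K) (fun s => ¬ P2 s) θ' * B K (In N) (Dm N p) = 0 := by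
    refine mul_B_eq_zero_of_mem_Sp (fun s hs hd => ?_) hθ2'
    obtain ⟨i, hi, hi'⟩ := Finset.not_subset.mp hs.2
    exact Finset.disjoint_left.mp hd hi (mem_Dm_of_not_mem_Gm hi')
  have hz2 : proj (K := K) P2 θ' * B K (In N) (Dm N p) = 0 := by
    have := congrArg (· * B K (In N) (Dm N p)) hsplit2
    simp only [add_mul, hz2', add_zero] at this
    rw [this, hsplit1, h2]
  have hv2 : proj (K := K) P2 θ' = 0 := eq_zero_of_mul_B_eq_zero K (disjoint_Dm_Gm p).symm hθ2 hz2
  rw [hv2, zero_add] at hsplit2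
  rw [← hsplit1, ← hsplit2]
  exact Sp_mono (fun s hs => ⟨hs.1.1.2, hs.1.2, hs.2⟩) hθ2'

/-- mixed degree-`m` forms kill both Weil vectors. -/
lemma mul_blocks_eq_zero_of_mem_Mm {m p : ℕ} {θ : HT K (In N)} (hθ : θ ∈ Mm K N m p) :
    θ * B K (In N) (Gm N p) = 0 ∧ θ * B K (In N) (Dm N p) = 0 := by
  constructor
  · refine mul_B_eq_zero_of_mem_Sp (fun s hs hd => ?_) hθ
    obtain ⟨i, hi, hi'⟩ := Finset.not_subset.mp hs.2.1
    exact Finset.disjoint_left.mp hd hi (mem_Gm_of_not_mem_Dm hi')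
  · refine mul_B_eq_zero_of_mem_Sp (fun s hs hd => ?_) hθ
    obtain ⟨i, hi, hi'⟩ := Finset.not_subset.mp hs.2.2
    exact Finset.disjoint_left.mp hd hi (mem_Dm_of_not_mem_Gm hi')

/-- **(E_m)** kernel identification in degree `m < N − p`. -/
theorem ker_eq_deg {m p : ℕ} (hm : m + 1 ≤ N - p) (q : ℕ → K) {a b : K} (ha : a ≠ 0) (hb : b ≠ 0) :
    Hom K (In N) Finset.univ m ⊓ LinearMap.ker (LinearMap.mulRight K (vW K N p q a b)) =
      Mm K N m p ⊓ LinearMap.ker (LinearMap.mulRight K (w K N N q)) := by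
  ext θ
  simp only [Submodule.mem_inf, LinearMap.mem_ker, LinearMap.mulRight_apply]
  constructor
  · rintro ⟨hθ, h0⟩
    obtain ⟨hf, hmx, hd⟩ := separation_deg K hm q hθ h0
    exact ⟨mem_Mm_of_mul_blocks_eq_zero K hθ (hmx ha) (hd hb), hf⟩
  · rintro ⟨hθ, h0⟩
    obtain ⟨hmx, hd⟩ := mul_blocks_eq_zero_of_mem_Mm K hθ
    refine ⟨Mm_le_Hom K m p hθ, ?_⟩
    rw [vW_mul_expand, h0, hmx, hd, smul_zero, smul_zero, add_zero, add_zero]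

/-! #### selections and their pieces -/

end AllDegrees

end Summit.Ventures.HSemireg.Wedge.Weil
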